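import Summits.QuantumFields.YangMills.Theorems.SwapVirialDeficitZeroModeGroupThreeSmallBallLimit
import Summits.QuantumFields.YangMills.Theorems.SwapVirialDeficitSigmaTwistedLetterFloor
import Literature.Analysis.Calculus.RadialCalculus
import HarnessLib

/-!
# Exact zero-mode rung Z5 — the σ-TWISTED FOUR-LEADER small ball, I: the event in the cone model and product coordinates
# (LEAD ym-line-sfw-p2 g93 07:46Z «`Haar⁴{E_σ(t)} = v₇t⁷(1 + O(t^θ))` … the natural next zero-mode rung»; free-hands support of ⟨stmt-QuantumFields-24197⟩)

The σ-twisted four-leader event of the swap-glued femto ring (✓`SigmaTwistedLetterFloor.haar_pi_sigmaTwisted_ge` (w2 g54) /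
✓`SigmaTwistedCeiling.haar_pi_sigmaTwisted_le` (LEAD g93): two-sided `≍ t⁷`, no logarithm) is, for four Haar letters `C : Fin 4 → SU(2)` read through
their unit quaternions `q_μ`, the event `E_σ(t)` that the relations of `π₁ = ℤ³ ⋊_σ ℤ` hold up to `t`:
`‖[q₀,q₁]‖, ‖[q₀,q₂]‖, ‖[q₁,q₂]‖ ≤ t` and `‖q₃q₁ − q₀q₃‖, ‖q₃q₀ − q₁q₃‖, ‖q₃q₂ − q₂q₃‖ ≤ t` (`sigmaBall t`; the six relations as a closed subset
`sigmaSet t ⊆ ℍ⁴`).  Toward the EXACT small-ball limit `Haar⁴(E_σ(t))/t⁷ → v₇` (this chain `…ZeroModeSigmaFourSmallBall*.lean`), this first file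
moves the event to the cone model of ✓`ToronLog.coneMeasure` (the radial projection of the normalised Lebesgue measure of the unit ball of `ℍ` is
Haar, ✓`ToronLog.measurePreserving_proj`) and to product coordinates adapted to the reduction of parts II–V:
* §1 `sigmaBall`, `sigmaSet`, ★ `sigmaBall_eq_preimage_sigmaSet` (the `∀ μ ν`-form is the six named relations, `t ≥ 0`);
* §2 unit vectors `radialUnit v = v/‖v‖` (✓`Literature.Analysis.Calculus.RadialCalculus`), `coneSigma`, ★ `haar_sigmaBall_eq_cone`;
* §3 product coordinates `(a, ((x, y), z)) = (C 3, ((C 0, C 2), C 1))` — hub `a` = the seam letter, `z` = the slaved letter: `arrange`,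
  `coneFour = cone ⊗ ((cone ⊗ cone) ⊗ cone)`, ★ `measurePreserving_arrange`, ★ `haar_sigmaBall_eq_prod`, `ae_coneFour_good`.
Part I-b (`…SmallBallSection`): hub straightening and the translation of the slaved letter; parts II–V: dilations (Jacobian `t⁷`), the limit
event, the dominator built from the four load-bearing constraints of LEAD g93's ceiling, dominated convergence.
HONEST LABEL: finite-dimensional measure theory on `SU(2)⁴` (plan-level zero-mode rung of the DRAFT line «sharp-sigma»); NOT the fixed-`L` sharp law,
NOT ⟨24197⟩; own crux ⟨22884⟩ OPEN (blocked-on ⟨19935⟩); the Yang–Mills mass gap is NOT proved; no summit is proved by a line.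
Width seat ym-line-sfw-p2-w3 g63 (cell ym-idea-1, free hands), `--supports stmt-QuantumFields-24197`.  Standard axioms, 0 `sorry`.
References: [cite: GonzalezarroyoAltes1988]; [cite: Vanbaal2001]; [cite: Luscher1983, §2]; [folklore].
-/

set_option autoImplicit false

noncomputable section

open MeasureTheory Quaternion Set
open scoped Quaternion ENNReal BigOperators
open Literature.MathematicalPhysics.QuantumLattice
open Literature.MathematicalPhysics.QuantumFieldTheory (haarProbability)
open Literature.MathematicalPhysics.QuantumFieldTheory.Balaban1983to89.T4HaarSU2Translate (su2Quat_quatToSU2 measurable_su2Quat)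
open Literature.Analysis.Calculus (radialUnit radialUnit_def norm_radialUnit)
open Summit.QuantumFields.YangMills.Theorems.SwapTwistDeficit.ToronLog
open Summit.QuantumFields.YangMills.Theorems.ToronValleyVolume.NearlyCommutingCeiling (norm_conj_of_norm_eq_one)
open Summit.QuantumFields.YangMills.Theorems.SwapVirialDeficit.ZeroModeGroup

attribute [local instance] Literature.Analysis.FluidPDE.Tao2016.quatMeasurableSpace
  Literature.Analysis.FluidPDE.Tao2016.quatBorelSpace
  Literature.MathematicalPhysics.QuantumLattice.secondCountableTopology_su2

namespace Summit.QuantumFields.YangMills.Theorems.SwapVirialDeficit.ZeroModeSigma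

/-! ## §1 The σ-twisted event and its six relations -/

/-- ★ **The σ-twisted four-leader small ball** `E_σ(t) ⊆ SU(2)⁴` — verbatim the event of ✓`haar_pi_sigmaTwisted_ge` / ✓`haar_pi_sigmaTwisted_le`:
`C 0, C 1, C 2` pairwise commute up to `t` and the seam letter `C 3` intertwines `C (σμ)` with `C μ` up to `t`, `σ = (0 1)`.
[cite: Luscher1983, §2] [cite: Vanbaal2001] -/
def sigmaBall (t : ℝ) : Set (Fin 4 → Matrix.specialUnitaryGroup (Fin 2) ℂ) :=
  {C | (∀ μ ν : Fin 3, ‖su2Quat (C μ.castSucc) * su2Quat (C ν.castSucc) - su2Quat (C ν.castSucc) * su2Quat (C μ.castSucc)‖ ≤ t) ∧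
    ∀ μ : Fin 3, ‖su2Quat (C (Fin.last 3)) * su2Quat (C (Equiv.swap (0 : Fin 3) 1 μ).castSucc) -
      su2Quat (C μ.castSucc) * su2Quat (C (Fin.last 3))‖ ≤ t}

/-- **The six relations of `ℤ³ ⋊_σ ℤ` up to `t`** as a subset of `ℍ⁴ ∋ (q₀, q₁, q₂, q₃)` (`q₁` the slaved letter, `q₃` the seam letter):
`‖[q₀,q₁]‖, ‖[q₀,q₂]‖, ‖[q₁,q₂]‖ ≤ t`, `‖q₃q₁ − q₀q₃‖ ≤ t`, `‖q₃q₀ − q₁q₃‖ ≤ t`, `‖q₃q₂ − q₂q₃‖ ≤ t`. [folklore] -/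
def sigmaSet (t : ℝ) : Set (ℍ × ℍ × ℍ × ℍ) :=
  {q | ‖q.1 * q.2.1 - q.2.1 * q.1‖ ≤ t ∧ ‖q.1 * q.2.2.1 - q.2.2.1 * q.1‖ ≤ t ∧ ‖q.2.1 * q.2.2.1 - q.2.2.1 * q.2.1‖ ≤ t ∧
    ‖q.2.2.2 * q.2.1 - q.1 * q.2.2.2‖ ≤ t ∧ ‖q.2.2.2 * q.1 - q.2.1 * q.2.2.2‖ ≤ t ∧ ‖q.2.2.2 * q.2.2.1 - q.2.2.1 * q.2.2.2‖ ≤ t}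

/-- Membership in `sigmaSet`, spelled out for a quadruple `(q₀, q₁, q₂, q₃)`. [folklore] -/
theorem mem_sigmaSet_iff (t : ℝ) (q₀ q₁ q₂ q₃ : ℍ) : (q₀, q₁, q₂, q₃) ∈ sigmaSet t ↔
    ‖q₀ * q₁ - q₁ * q₀‖ ≤ t ∧ ‖q₀ * q₂ - q₂ * q₀‖ ≤ t ∧ ‖q₁ * q₂ - q₂ * q₁‖ ≤ t ∧
      ‖q₃ * q₁ - q₀ * q₃‖ ≤ t ∧ ‖q₃ * q₀ - q₁ * q₃‖ ≤ t ∧ ‖q₃ * q₂ - q₂ * q₃‖ ≤ t := Iff.rfl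

/-- ★ **`E_σ(t)` is the event of the six relations** on `q_μ = su2Quat (C μ)` (`t ≥ 0`; the diagonal relations are trivial and the pair relations
symmetric). [folklore] -/
theorem sigmaBall_eq_preimage_sigmaSet {t : ℝ} (ht : 0 ≤ t) :
    sigmaBall t = {C | (su2Quat (C 0), su2Quat (C 1), su2Quat (C 2), su2Quat (C 3)) ∈ sigmaSet t} := by
  have c0 : ((0 : Fin 3).castSucc : Fin 4) = 0 := by decide
  have c1 : ((1 : Fin 3).castSucc : Fin 4) = 1 := by decide
  have c2 : ((2 : Fin 3).castSucc : Fin 4) = 2 := by decide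
  have c3 : (Fin.last 3 : Fin 4) = 3 := by decide
  have sw0 : (Equiv.swap (0 : Fin 3) 1) 0 = 1 := by decide
  have sw1 : (Equiv.swap (0 : Fin 3) 1) 1 = 0 := by decide
  have sw2 : (Equiv.swap (0 : Fin 3) 1) 2 = 2 := by decide
  ext C
  simp only [sigmaBall, Set.mem_setOf_eq, mem_sigmaSet_iff]
  constructor
  · rintro ⟨hcomm, htw⟩
    have h01 := hcomm 0 1; rw [c0, c1] at h01
    have h02 := hcomm 0 2; rw [c0, c2] at h02
    have h12 := hcomm 1 2; rw [c1, c2] at h12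
    have hT0 := htw 0; rw [sw0, c1, c0, c3] at hT0
    have hT1 := htw 1; rw [sw1, c0, c1, c3] at hT1
    have hT2 := htw 2; rw [sw2, c2, c3] at hT2
    exact ⟨h01, h02, h12, hT0, hT1, hT2⟩
  · rintro ⟨h01, h02, h12, hT0, hT1, hT2⟩
    have hdiag : ∀ i : Fin 4, ‖su2Quat (C i) * su2Quat (C i) - su2Quat (C i) * su2Quat (C i)‖ ≤ t := by
      intro i; rw [sub_self, norm_zero]; exact ht
    have h10 : ‖su2Quat (C 1) * su2Quat (C 0) - su2Quat (C 0) * su2Quat (C 1)‖ ≤ t := by rw [norm_sub_rev]; exact h01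
    have h20 : ‖su2Quat (C 2) * su2Quat (C 0) - su2Quat (C 0) * su2Quat (C 2)‖ ≤ t := by rw [norm_sub_rev]; exact h02
    have h21 : ‖su2Quat (C 2) * su2Quat (C 1) - su2Quat (C 1) * su2Quat (C 2)‖ ≤ t := by rw [norm_sub_rev]; exact h12
    refine ⟨fun μ ν => ?_, fun μ => ?_⟩
    · fin_cases μ <;> fin_cases ν
      · exact hdiag 0
      · exact h01
      · exact h02
      · exact h10
      · exact hdiag 1
      · exact h12
      · exact h20
      · exact h21
      · exact hdiag 2
    · fin_cases μ
      · exact hT0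
      · exact hT1
      · exact hT2

/-- `E_σ(t)` is measurable (✓`SigmaTwistedLetterFloor.measurableSet_sigmaTwisted`). [folklore] -/
theorem measurableSet_sigmaBall (t : ℝ) : MeasurableSet (sigmaBall t) :=
  SigmaTwistedLetterFloor.measurableSet_sigmaTwisted t

/-- `sigmaSet t` is closed in its arguments, hence measurable. [folklore] -/
theorem measurableSet_sigmaSet (t : ℝ) : MeasurableSet (sigmaSet t) := by
  have h0 : Continuous fun q : ℍ × ℍ × ℍ × ℍ => q.1 := continuous_fst
  have h1 : Continuous fun q : ℍ × ℍ × ℍ × ℍ => q.2.1 := continuous_fst.comp continuous_snd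
  have h2 : Continuous fun q : ℍ × ℍ × ℍ × ℍ => q.2.2.1 := continuous_fst.comp (continuous_snd.comp continuous_snd)
  have h3 : Continuous fun q : ℍ × ℍ × ℍ × ℍ => q.2.2.2 := continuous_snd.comp (continuous_snd.comp continuous_snd)
  have hs : ∀ {f g h k : ℍ × ℍ × ℍ × ℍ → ℍ}, Continuous f → Continuous g → Continuous h → Continuous k →
      MeasurableSet {q : ℍ × ℍ × ℍ × ℍ | ‖f q * g q - h q * k q‖ ≤ t} := fun hf hg hh hk =>
    measurableSet_le ((hf.mul hg).sub (hh.mul hk)).norm.measurable measurable_const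
  simp only [sigmaSet, Set.setOf_and]
  exact (hs h0 h1 h1 h0).inter ((hs h0 h2 h2 h0).inter ((hs h1 h2 h2 h1).inter ((hs h3 h1 h0 h3).inter ((hs h3 h0 h1 h3).inter
    (hs h3 h2 h2 h3)))))

/-- Measurability of events `{ω | (F₀ ω, F₁ ω, F₂ ω, F₃ ω) ∈ sigmaSet t}` for measurable letters `F_i`. [folklore] -/
theorem measurableSet_preimage_sigmaSet {α : Type*} [MeasurableSpace α] (t : ℝ) {F₀ F₁ F₂ F₃ : α → ℍ}
    (h₀ : Measurable F₀) (h₁ : Measurable F₁) (h₂ : Measurable F₂) (h₃ : Measurable F₃) :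
    MeasurableSet {ω : α | (F₀ ω, F₁ ω, F₂ ω, F₃ ω) ∈ sigmaSet t} :=
  (measurableSet_sigmaSet t).preimage (h₀.prodMk (h₁.prodMk (h₂.prodMk h₃)))

/-! ## §2 The cone model -/

/-- `su2Quat (quatToSU2 v) = radialUnit v = v/‖v‖` for `v ≠ 0` (✓`su2Quat_quatToSU2`). [folklore] -/
theorem su2Quat_quatToSU2_eq_radialUnit {v : ℍ} (hv : v ≠ 0) : su2Quat (quatToSU2 v) = radialUnit v :=
  su2Quat_quatToSU2 hv

/-- `radialUnit : ℍ → ℍ` is measurable. [folklore] -/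
theorem measurable_radialUnit : Measurable (radialUnit : ℍ → ℍ) := by
  have h : (radialUnit : ℍ → ℍ) = fun v => ‖v‖⁻¹ • v := funext fun v => radialUnit_def v
  rw [h]
  exact (continuous_norm.measurable.inv).smul measurable_id

/-- Left multiplication by a unit quaternion commutes with normalisation: `radialUnit (p·v) = p·radialUnit v`. [folklore] -/
theorem radialUnit_mul_left {p : ℍ} (hp : ‖p‖ = 1) (v : ℍ) : radialUnit (p * v) = p * radialUnit v := by
  rw [radialUnit_def, radialUnit_def, norm_mul, hp, one_mul, mul_smul_comm]

/-- Conjugation by a unit quaternion commutes with normalisation: `radialUnit (ū v u) = ū (radialUnit v) u`. [folklore] -/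
theorem radialUnit_conj {u : ℍ} (hu : ‖u‖ = 1) (v : ℍ) : radialUnit (star u * v * u) = star u * radialUnit v * u := by
  rw [radialUnit_def, radialUnit_def, norm_conj_of_norm_eq_one hu, mul_smul_comm, smul_mul_assoc]

/-- The cone-model event: the six relations for the unit vectors of four quaternions `v 0, v 1, v 2, v 3`. [folklore] -/
def coneSigma (t : ℝ) : Set (Fin 4 → ℍ) :=
  {v | (radialUnit (v 0), radialUnit (v 1), radialUnit (v 2), radialUnit (v 3)) ∈ sigmaSet t}

/-- The cone-model event is measurable. [folklore] -/
theorem measurableSet_coneSigma (t : ℝ) : MeasurableSet (coneSigma t) :=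
  measurableSet_preimage_sigmaSet t (measurable_radialUnit.comp (measurable_pi_apply 0)) (measurable_radialUnit.comp (measurable_pi_apply 1))
    (measurable_radialUnit.comp (measurable_pi_apply 2)) (measurable_radialUnit.comp (measurable_pi_apply 3))

/-- Almost every point of `cone⁴` has all four letters non-zero. [folklore] -/
theorem ae_ne_zero_pi_four : ∀ᵐ v : Fin 4 → ℍ ∂(Measure.pi fun _ : Fin 4 => coneMeasure), ∀ μ : Fin 4, v μ ≠ 0 := by
  haveI := isProbabilityMeasure_coneMeasure
  rw [ae_all_iff]
  intro μ
  have h0 : (Measure.pi fun _ : Fin 4 => coneMeasure) (Function.eval μ ⁻¹' ({0} : Set ℍ)) = 0 :=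
    Measure.pi_eval_preimage_null _ coneMeasure_singleton_zero
  rw [ae_iff]
  refine measure_mono_null (fun v hv => ?_) h0
  simp only [ne_eq, not_not, Set.mem_setOf_eq] at hv
  exact hv

/-- ★ **`Haar⁴(E_σ(t))` in the cone model**: `= cone⁴{v | six relations for the unit vectors of v μ}` (`t ≥ 0`). [folklore] -/
theorem haar_sigmaBall_eq_cone {t : ℝ} (ht : 0 ≤ t) :
    (Measure.pi fun _ : Fin 4 => haarProbability (Matrix.specialUnitaryGroup (Fin 2) ℂ)) (sigmaBall t) =
      (Measure.pi fun _ : Fin 4 => coneMeasure) (coneSigma t) := by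
  haveI := isProbabilityMeasure_coneMeasure
  rw [← measurePreserving_proj.measure_preimage (measurableSet_sigmaBall t).nullMeasurableSet]
  refine measure_congr ?_
  filter_upwards [ae_ne_zero_pi_four] with v hv
  simp only [eq_iff_iff]
  change (fun μ => quatToSU2 (v μ)) ∈ sigmaBall t ↔ v ∈ coneSigma t
  rw [sigmaBall_eq_preimage_sigmaSet ht]
  simp only [coneSigma, Set.mem_setOf_eq, su2Quat_quatToSU2_eq_radialUnit (hv 0), su2Quat_quatToSU2_eq_radialUnit (hv 1),
    su2Quat_quatToSU2_eq_radialUnit (hv 2), su2Quat_quatToSU2_eq_radialUnit (hv 3)]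

/-! ## §3 Product coordinates `(a, ((x, y), z))`: hub = seam letter `C 3`, pair `(C 0, C 2)`, slaved letter `C 1` -/

/-- The arrangement `v ↦ (v 3, ((v 0, v 2), v 1))`. [folklore] -/
def arrange (v : Fin 4 → ℍ) : ℍ × ((ℍ × ℍ) × ℍ) := (v 3, ((v 0, v 2), v 1))

/-- Unfolding `arrange`. [folklore] -/
theorem arrange_apply (v : Fin 4 → ℍ) : arrange v = (v 3, ((v 0, v 2), v 1)) := rfl

/-- The three-letter cone measure `(cone ⊗ cone) ⊗ cone` of the non-hub letters `((x, y), z)`. [folklore] -/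
def coneThree : Measure ((ℍ × ℍ) × ℍ) := (coneMeasure.prod coneMeasure).prod coneMeasure

/-- `coneThree` unfolded. [folklore] -/
theorem coneThree_def : coneThree = (coneMeasure.prod coneMeasure).prod coneMeasure := rfl

/-- The product cone measure in the arranged coordinates: `coneFour = cone ⊗ coneThree`. [folklore] -/
def coneFour : Measure (ℍ × ((ℍ × ℍ) × ℍ)) := coneMeasure.prod coneThree

/-- `coneFour` unfolded. [folklore] -/
theorem coneFour_def : coneFour = coneMeasure.prod ((coneMeasure.prod coneMeasure).prod coneMeasure) := rfl

/-- `coneThree` is a probability measure. [folklore] -/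
theorem isProbabilityMeasure_coneThree : IsProbabilityMeasure coneThree := by
  haveI := isProbabilityMeasure_coneMeasure
  rw [coneThree_def]; infer_instance

/-- `coneFour` is a probability measure. [folklore] -/
theorem isProbabilityMeasure_coneFour : IsProbabilityMeasure coneFour := by
  haveI := isProbabilityMeasure_coneMeasure
  haveI := isProbabilityMeasure_coneThree
  rw [coneFour]; infer_instance

/-- The inner rearrangement `w ↦ ((w 0, w 2), w 1)` of `Fin 3 → ℍ` (split off letter `1`, pair the rest). [folklore] -/
theorem measurePreserving_arrange_three :
    MeasurePreserving (fun w : Fin 3 → ℍ => ((w 0, w 2), w 1)) (Measure.pi fun _ : Fin 3 => coneMeasure) coneThree := by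
  haveI := isProbabilityMeasure_coneMeasure
  have h2 := measurePreserving_piFinSuccAbove (fun _ : Fin 3 => coneMeasure) 1
  have h3 : MeasurePreserving (Prod.map id MeasurableEquiv.finTwoArrow : ℍ × (Fin 2 → ℍ) → ℍ × (ℍ × ℍ))
      (coneMeasure.prod (Measure.pi fun _ : Fin 2 => coneMeasure)) (coneMeasure.prod (coneMeasure.prod coneMeasure)) :=
    (MeasurePreserving.id coneMeasure).prod (measurePreserving_finTwoArrow coneMeasure)
  have hswap : MeasurePreserving (Prod.swap : ℍ × (ℍ × ℍ) → (ℍ × ℍ) × ℍ) (coneMeasure.prod (coneMeasure.prod coneMeasure)) coneThree := by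
    rw [coneThree_def]; exact Measure.measurePreserving_swap
  have hcomp := (hswap.comp h3).comp h2
  have heq : (Prod.swap ∘ (Prod.map id MeasurableEquiv.finTwoArrow : ℍ × (Fin 2 → ℍ) → ℍ × (ℍ × ℍ))) ∘
      (MeasurableEquiv.piFinSuccAbove (fun _ : Fin 3 => ℍ) 1) = fun w : Fin 3 → ℍ => ((w 0, w 2), w 1) := by
    funext w
    have he : MeasurableEquiv.piFinSuccAbove (fun _ : Fin 3 => ℍ) 1 w = (w 1, ![w 0, w 2]) := by
      rw [MeasurableEquiv.piFinSuccAbove_apply]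
      refine Prod.ext rfl (funext fun j => ?_)
      fin_cases j <;> rfl
    simp only [Function.comp_apply, he, Prod.map_apply, id, MeasurableEquiv.finTwoArrow_apply, Prod.swap_prod_mk,
      Matrix.cons_val_zero, Matrix.cons_val_one]
  rw [heq] at hcomp
  exact hcomp

/-- ★ `arrange` maps `cone⁴` to `coneFour = cone ⊗ ((cone ⊗ cone) ⊗ cone)` (split off the hub `3`, then rearrange the rest). [folklore] -/
theorem measurePreserving_arrange : MeasurePreserving arrange (Measure.pi fun _ : Fin 4 => coneMeasure) coneFour := by
  haveI := isProbabilityMeasure_coneMeasure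
  have h1 := measurePreserving_piFinSuccAbove (fun _ : Fin 4 => coneMeasure) (Fin.last 3)
  have hprod : MeasurePreserving (Prod.map id (fun w : Fin 3 → ℍ => ((w 0, w 2), w 1)))
      (coneMeasure.prod (Measure.pi fun _ : Fin 3 => coneMeasure)) coneFour := by
    rw [coneFour]; exact (MeasurePreserving.id coneMeasure).prod measurePreserving_arrange_three
  have hcomp := hprod.comp h1
  have heq : (Prod.map id (fun w : Fin 3 → ℍ => ((w 0, w 2), w 1))) ∘ (MeasurableEquiv.piFinSuccAbove (fun _ : Fin 4 => ℍ) (Fin.last 3)) =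
      arrange := by
    funext v
    have he : MeasurableEquiv.piFinSuccAbove (fun _ : Fin 4 => ℍ) (Fin.last 3) v = (v 3, ![v 0, v 1, v 2]) := by
      rw [MeasurableEquiv.piFinSuccAbove_apply]
      refine Prod.ext rfl (funext fun j => ?_)
      fin_cases j <;> rfl
    simp only [Function.comp_apply, he, Prod.map_apply, id, arrange, Matrix.cons_val_zero, Matrix.cons_val_one, Matrix.cons_val_two,
      Matrix.tail_cons, Matrix.head_cons]
  rw [heq] at hcomp
  exact hcomp

/-- The event in the arranged coordinates `q = (a, ((x, y), z))`: relations for `(x̂, ẑ, ŷ, â)`. [folklore] -/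
def prodSigma (t : ℝ) : Set (ℍ × ((ℍ × ℍ) × ℍ)) :=
  {q | (radialUnit q.2.1.1, radialUnit q.2.2, radialUnit q.2.1.2, radialUnit q.1) ∈ sigmaSet t}

/-- `prodSigma t` is measurable. [folklore] -/
theorem measurableSet_prodSigma (t : ℝ) : MeasurableSet (prodSigma t) :=
  measurableSet_preimage_sigmaSet t (measurable_radialUnit.comp (measurable_fst.comp (measurable_fst.comp measurable_snd)))
    (measurable_radialUnit.comp (measurable_snd.comp measurable_snd))
    (measurable_radialUnit.comp (measurable_snd.comp (measurable_fst.comp measurable_snd))) (measurable_radialUnit.comp measurable_fst)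

/-- `coneSigma t` is the preimage of `prodSigma t` under `arrange`. [folklore] -/
theorem coneSigma_eq_preimage (t : ℝ) : coneSigma t = arrange ⁻¹' prodSigma t := rfl

/-- ★ **`Haar⁴(E_σ(t))` in arranged cone coordinates**: `= coneFour (prodSigma t)` (`t ≥ 0`). [folklore] -/
theorem haar_sigmaBall_eq_prod {t : ℝ} (ht : 0 ≤ t) :
    (Measure.pi fun _ : Fin 4 => haarProbability (Matrix.specialUnitaryGroup (Fin 2) ℂ)) (sigmaBall t) = coneFour (prodSigma t) := by
  rw [haar_sigmaBall_eq_cone ht, coneSigma_eq_preimage, measurePreserving_arrange.measure_preimage (measurableSet_prodSigma t).nullMeasurableSet]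

/-- Cone-almost surely the hub is non-zero. [folklore] -/
theorem ae_ne_zero_coneMeasure : ∀ᵐ a : ℍ ∂coneMeasure, a ≠ 0 := by
  rw [ae_iff]; simpa only [ne_eq, not_not, Set.setOf_eq_eq_singleton] using coneMeasure_singleton_zero

/-- ★ **The good set**: `coneFour`-almost surely the hub has `q(a) ≠ 0` (✓`ae_coneQ_ne_zero`) and all four letters are non-zero. [folklore] -/
theorem ae_coneFour_good :
    ∀ᵐ q : ℍ × ((ℍ × ℍ) × ℍ) ∂coneFour, coneQ q.1 ≠ 0 ∧ q.1 ≠ 0 ∧ q.2.1.1 ≠ 0 ∧ q.2.1.2 ≠ 0 ∧ q.2.2 ≠ 0 := by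
  haveI := isProbabilityMeasure_coneMeasure
  haveI := isProbabilityMeasure_coneThree
  have hfst : Measure.QuasiMeasurePreserving (Prod.fst : ℍ × ((ℍ × ℍ) × ℍ) → ℍ) coneFour coneMeasure := by
    rw [coneFour]; exact Measure.quasiMeasurePreserving_fst
  have hsnd : Measure.QuasiMeasurePreserving (Prod.snd : ℍ × ((ℍ × ℍ) × ℍ) → (ℍ × ℍ) × ℍ) coneFour coneThree := by
    rw [coneFour]; exact Measure.quasiMeasurePreserving_snd
  have hx : Measure.QuasiMeasurePreserving (fun w : (ℍ × ℍ) × ℍ => w.1.1) coneThree coneMeasure := by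
    rw [coneThree_def]; exact Measure.quasiMeasurePreserving_fst.comp Measure.quasiMeasurePreserving_fst
  have hy : Measure.QuasiMeasurePreserving (fun w : (ℍ × ℍ) × ℍ => w.1.2) coneThree coneMeasure := by
    rw [coneThree_def]; exact Measure.quasiMeasurePreserving_snd.comp Measure.quasiMeasurePreserving_fst
  have hz : Measure.QuasiMeasurePreserving (fun w : (ℍ × ℍ) × ℍ => w.2) coneThree coneMeasure := by
    rw [coneThree_def]; exact Measure.quasiMeasurePreserving_snd
  have h1 : ∀ᵐ q : ℍ × ((ℍ × ℍ) × ℍ) ∂coneFour, coneQ q.1 ≠ 0 := hfst.ae ae_coneQ_ne_zero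
  have h2 : ∀ᵐ q : ℍ × ((ℍ × ℍ) × ℍ) ∂coneFour, q.1 ≠ 0 := hfst.ae ae_ne_zero_coneMeasure
  have h3 : ∀ᵐ q : ℍ × ((ℍ × ℍ) × ℍ) ∂coneFour, q.2.1.1 ≠ 0 := hsnd.ae (hx.ae ae_ne_zero_coneMeasure)
  have h4 : ∀ᵐ q : ℍ × ((ℍ × ℍ) × ℍ) ∂coneFour, q.2.1.2 ≠ 0 := hsnd.ae (hy.ae ae_ne_zero_coneMeasure)
  have h5 : ∀ᵐ q : ℍ × ((ℍ × ℍ) × ℍ) ∂coneFour, q.2.2 ≠ 0 := hsnd.ae (hz.ae ae_ne_zero_coneMeasure)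
  filter_upwards [h1, h2, h3, h4, h5] with q a b c d e using ⟨a, b, c, d, e⟩

/-- The same good set for `coneThree`: all three letters non-zero. [folklore] -/
theorem ae_coneThree_ne_zero : ∀ᵐ w : (ℍ × ℍ) × ℍ ∂coneThree, w.1.1 ≠ 0 ∧ w.1.2 ≠ 0 ∧ w.2 ≠ 0 := by
  haveI := isProbabilityMeasure_coneMeasure
  have hx : Measure.QuasiMeasurePreserving (fun w : (ℍ × ℍ) × ℍ => w.1.1) coneThree coneMeasure := by
    rw [coneThree_def]; exact Measure.quasiMeasurePreserving_fst.comp Measure.quasiMeasurePreserving_fst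
  have hy : Measure.QuasiMeasurePreserving (fun w : (ℍ × ℍ) × ℍ => w.1.2) coneThree coneMeasure := by
    rw [coneThree_def]; exact Measure.quasiMeasurePreserving_snd.comp Measure.quasiMeasurePreserving_fst
  have hz : Measure.QuasiMeasurePreserving (fun w : (ℍ × ℍ) × ℍ => w.2) coneThree coneMeasure := by
    rw [coneThree_def]; exact Measure.quasiMeasurePreserving_snd
  filter_upwards [hx.ae ae_ne_zero_coneMeasure, hy.ae ae_ne_zero_coneMeasure, hz.ae ae_ne_zero_coneMeasure] with w a b c
    using ⟨a, b, c⟩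

end Summit.QuantumFields.YangMills.Theorems.SwapVirialDeficit.ZeroModeSigma

end
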